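import Summits.BirchSwinnertonDyer.BirchSwinnertonDyer.Theorems.PrintCFramBottomClassIndexLawFiveLeHeegnerFieldSupplyCuspSplit
import Summits.BirchSwinnertonDyer.BirchSwinnertonDyer.Theorems.PrintCFramBottomClassIndexLawFiveLeGenusInternalRoutingClassDatum
import HarnessLib

/-!
# Crux `PrintCFram.BottomClassIndexLawFiveLe` (stmt-BirchSwinnertonDyer-20372), line `eisenstein-resource-bdp-line` (registry v25/v26):
# THE SEED CHAIN WITH THE GENUS-INTERNAL CARVE-OUT — routing kit for the genus-internal branch, part 2a (§0–§1; §2–§3 in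
# the sibling `…GenusInternalRoutingWStep`)
# (cell `bsd-print-cfram`, width seat `bsd-line-cfram-p1-w2` g14; THEOREMS ONLY, `--supports` 20372; BSD is not proved by any of this)

HONEST FRAMING. Nothing here is a statement about BSD and no stub is closed. The registry's analytic chain reads
(AtP⁶) ∧ (CuspSeed⁶) ∧ (SeedOffExc⁶) ⟹ Stub C for EVERY class member with a unit class factor
(`HeegnerFieldSupply.stubC_of_atP_of_cuspSeed_of_exc`, LEAD g12, consumed by `_of` through w8 g6's END STATE). The
genus-internal branch (bsd-idea-7 g19/g20, idea-crit-10 V#146/V#147; w6 g8 p702209/p703056, w7 g7 p702528/p703018 + `bsdp_twist_cm7_of_regular`,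
w3 g16 p703060) proves `BSD_7(W)` DIRECTLY for the members `W ∼ cm7^{(e)}` with `e < 0`, `e ≡ 1 (mod 4)`, `(e/7) = +1` and a unit class
factor — WITHOUT an admissible split Heegner field. So those classes can be CARVED OUT of the research stub `stub_seedOffExc`, provided
the chain routes the carved members to the branch. This file does the routing:

* §1 `splitPrimes_six_of_atP_of_cuspSeed_of_excOffGI` — the curve-free chain ((AtP⁶), (CuspSeed⁶), the on-locus seed `seedOn_six`, and
  (SeedOffExc⁶) WITH THE CARVE-OUT `¬(p = 7 ∧ χ(−1) = −1 ∧ χ(7) = 1)`) yields the split-primes conclusion `(P⁶)` for every class datum satisfying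
  the side condition `p = 7 → χ(−1) = −1 → χ(7) = 1 → ¬(cusp-exceptional)`; pure logic (case split on cusp-exceptional / locus).
* §2 `stubC_or_twistingField_of_splitPrimes_six_offGI` — THE W-STEP WITH THE DISJUNCTION: for every class member `W` (CM, `p ≥ 5`
  CM-ramified, `r_an = 1`) with odd datum `(f, ψ, ω)`, `hss` and a UNIT class factor, EITHER Stub C's conclusion (an admissible Heegner
  field of `N_W` with unit field factor) OR the GENUS-INTERNAL DATUM: `p = 7`, a globally minimal `W₁ ∼ W` with
  `C • cm7^{(d_K)} = W₁` and `r_an(W₁) = 1`, `K = ℚ(√e)` imaginary quadratic with `d_K ∈ {e, 4e}` `< −4` (EITHER PARITY), `7 ∤ d_K`,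
  `7` split in `K` (Heegner for `49`), a cusp-exceptional prime of `d_K`, its Kronecker character `ε_K`, and regularity `7 ∤ B_{5,ε_K}/5` —
  the hypotheses of w7 g7's `GenusInternal.bsdp_twist_cm7_of_regular_kronecker` / `bsdp_of_isIsogenous_twist_cm7_of_regular_kronecker`
  (parity-free) and of w6 g8's `not_isOfFinAddOrder_heegnerPoint_cm7_of_regular_kronecker`. The bridge is part 1's class datum WITH its
  twisting presentation (`GenusInternalRouting.exists_krizLiDataDict_of_cmRamified_seven`) read through the dictionary: odd level `m = |e|`,
  `χ = (· | |e|)` (`χ(−1) = −1 ⟹ e < 0` by `χ₄`, `χ(7) = J(7 | |e|) = J(e | 7)` by reciprocity); even level `m = 4|e|`, `χ = [· odd]·(e | ·)`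
  (`χ(−1) = (e | 4|e|−1) = sign e` — §0 — and `χ(7) = (e | 7)` directly; `ε_K` packaged by `OffLocusDictionary.isKroneckerCharacterOf_kroneckerFourPadic`).
* §3 `stubC_or_twistingField_of_atP_of_cuspSeed_of_excOffGI` — §2 ∘ §1: (AtP⁶) ∧ (CuspSeed⁶) ∧ (SeedOffExc⁶ with the carve-out) ⟹
  «Stub C ∨ genus-internal datum» member-wise. Part 3 (`…GenusInternalRoutingEndState`) feeds v18's B2′ slot with it.
* §0 the even sign lemma `kroneckerFour_apply_neg_one_of_pos` (`e > 0`, `e ≡ 2,3 (mod 4)` ⟹ `χ(−1) = 1` for `χ = [· odd]·(e | ·)` mod `4|e|`;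
  the mirror of the tree's `apply_neg_one_of_forall_odd`) and `neg_of_kroneckerFour_apply_neg_one`.

PARITY-FREE: the carve-out has no parity clause, so both the odd (`−83, −87, −139, −143`) and the even (`−52, −104`) exceptional classes with
`(e*/7) = +1` of LEAD g13 §4 leave the research stub. beyond-print theorem: NO.
References: [KrizLi2019] Thm. 1.20 (pp. 7–8), §8 (pp. 49–52); [Cox2013] §1.C Lemma 1.14, §5 Prop. 5.16; [Cohen1975] Thm. 3.1;
registry `Cruxes/BottomClassIndexLawFiveLe/Lines/eisenstein_resource_bdp_line.lean`.
-/

set_option autoImplicit false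
-- summit-side namespace `Summit.BirchSwinnertonDyer.BirchSwinnertonDyer.…` (single-conjunct summit, D-0017 layout)
set_option linter.dupNamespace false

noncomputable section

open scoped Classical NumberTheorySymbols
open NumberField WeierstrassCurve DirichletCharacter Literature.NumberTheory.LFunctions
  Literature.NumberTheory.EllipticCurves Literature.NumberTheory.EllipticCurves.KrizLi2019
  Literature.NumberTheory.EllipticCurves.Rank1Residual
open Literature.NumberTheory.Congruences Literature.NumberTheory.QuadraticFields

namespace Summit.BirchSwinnertonDyer.BirchSwinnertonDyer.Theorems.PrintCFram.GenusInternalRouting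

open Summit.BirchSwinnertonDyer.BirchSwinnertonDyer.Theorems.PrintCFram
open Summit.BirchSwinnertonDyer.BirchSwinnertonDyer.Theorems.PrintCFram.KummerDictionary
open Summit.BirchSwinnertonDyer.BirchSwinnertonDyer.Theorems.PrintCFram.HeegnerFieldSupply
open Summit.BirchSwinnertonDyer.Rank1Residual Summit.BirchSwinnertonDyer.Rank1Residual.X12.O11

/-! ## §0 The even sign lemma (the mirror of the tree's `apply_neg_one_of_forall_odd`) -/

section EvenSign

variable {p : ℕ} [hp : Fact p.Prime]

/-- **`χ(−1) = 1` for the `ℚ_p`-valued Kronecker character `a ↦ [a odd]·(e | a)` mod `4|e|` of a POSITIVE `e ≡ 2, 3 (mod 4)`:**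
`χ(−1) = (e | 4e − 1) = 1` by reciprocity at each odd prime of `e` and `(2 | 4e−1) = 1` (`4e − 1 ≡ 7 (mod 8)` when `e` is even) — the
mirror image of the tree's `apply_neg_one_of_forall_odd` (`e < 0 ⟹ χ(−1) = −1`). [cite: Cox2013, §1.C Lemma 1.14] -/
theorem kroneckerFour_apply_neg_one_of_pos {e : ℤ} (he : 0 < e) (he4 : e % 4 = 2 ∨ e % 4 = 3) {n : ℕ} [NeZero n]
    (hn : n = 4 * e.natAbs) {χ : DirichletCharacter ℚ_[p] n}
    (hχ : ∀ a : ℕ, χ (a : ZMod n) = ((if Even a then (0 : ℤ) else J(e | a) : ℤ) : ℚ_[p])) :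
    χ (-1) = 1 := by
  subst hn
  have het : (e.natAbs : ℤ) = e := Int.natAbs_of_nonneg he.le
  set t := e.natAbs with ht
  have ht0 : 0 < t := by omega
  have hcast : ((4 * t - 1 : ℕ) : ZMod (4 * t)) = -1 := by
    rw [Nat.cast_sub (by omega), Nat.cast_one, ZMod.natCast_self, zero_sub]
  have hodd : _root_.Odd (4 * t - 1) := Nat.odd_iff.mpr (by omega)
  have hb4 : (4 * t - 1) % 4 = 3 := by omega
  rw [← hcast, hχ _, if_neg (Nat.not_even_iff_odd.mpr hodd), ← het]
  -- `J(t | 4t − 1) = 1`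
  suffices h : J((t : ℤ) | 4 * t - 1) = 1 by rw [h]; norm_num
  rcases he4 with h4 | h4
  · -- `e ≡ 2 (mod 4)`: `t = 2 t₀` with `t₀` odd
    obtain ⟨t₀, ht₀⟩ : 2 ∣ t := by omega
    have ht₀odd : _root_.Odd t₀ := Nat.odd_iff.mpr (by omega)
    rw [show (t : ℤ) = 2 * (t₀ : ℤ) by rw [ht₀]; push_cast; ring, jacobiSym.mul_left,
      jacobiSym.at_two hodd, (χ₈_nat_of_mod_eight (b := 4 * t - 1)).1 (by omega), one_mul]
    refine jacobiSym_eq_one_of_mod_four_eq_three_of_emod_eq_neg_one ht₀odd hb4 ?_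
    rw [Nat.cast_sub (by omega)]
    push_cast
    rw [show (4 : ℤ) * (t : ℤ) - 1 = -1 + (t₀ : ℤ) * 8 by rw [ht₀]; push_cast; ring,
      Int.add_mul_emod_self_left]
  · -- `e ≡ 3 (mod 4)`: `t` odd
    have htodd : _root_.Odd t := Nat.odd_iff.mpr (by omega)
    refine jacobiSym_eq_one_of_mod_four_eq_three_of_emod_eq_neg_one htodd hb4 ?_
    rw [Nat.cast_sub (by omega)]
    push_cast
    rw [show (4 : ℤ) * (t : ℤ) - 1 = -1 + (t : ℤ) * 4 by ring, Int.add_mul_emod_self_left]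

/-- **`χ(−1) = −1 ⟹ e < 0`** for the even-level class character `[· odd]·(e | ·)` mod `4|e|`, `e ≡ 2, 3 (mod 4)`. [cite: Cox2013, §1.C Lemma 1.14] -/
theorem neg_of_kroneckerFour_apply_neg_one {e : ℤ} (he4 : e % 4 = 2 ∨ e % 4 = 3) {n : ℕ} [NeZero n]
    (hn : n = 4 * e.natAbs) {χ : DirichletCharacter ℚ_[p] n}
    (hχ : ∀ a : ℕ, χ (a : ZMod n) = ((if Even a then (0 : ℤ) else J(e | a) : ℤ) : ℚ_[p])) (h : χ (-1) = -1) :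
    e < 0 := by
  rcases lt_trichotomy e 0 with hlt | rfl | hgt
  · exact hlt
  · simp at he4
  · exfalso
    rw [kroneckerFour_apply_neg_one_of_pos hgt he4 hn hχ] at h
    norm_num at h

end EvenSign

/-! ## §1 The curve-free chain with the carve-out threaded -/

/-- **`(P⁶)` on the non-carved class data ⟸ (AtP⁶) ∧ (CuspSeed⁶) ∧ (SeedOffExc⁶ WITH THE GENUS-INTERNAL CARVE-OUT).** For every class
datum `(p, m, χ, k)` at the six leaf primes satisfying the side condition «`p = 7 → ¬2∣m → χ(−1) = −1 → χ(7) = 1 →` not cusp-exceptional»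
and with a unit class factor, an imaginary quadratic `K` (`d_K` odd `< −4`) in which every prime of `p·m` splits, with a Kronecker
character and a unit field factor. Case split: cusp-exceptional and on the locus `L(m,p)` ⟹ w8 g5's `seedOn_six`; cusp-exceptional and off
the locus ⟹ `hExcGI` (the carve-out is discharged by the side condition); not cusp-exceptional ⟹ `hCusp`; then (AtP⁶) propagates the seed
across the Legendre classes at `p`. Pure logic. [cite: Cohen1975, Thm. 3.1] [cite: AhlgrenBoylan2003, Thm. 3] [cite: KrizLi2019, §8 (pp. 49–52)] -/
theorem splitPrimes_six_of_atP_of_cuspSeed_of_excOffGI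
    (hAt : ∀ (p : ℕ) [Fact p.Prime] (m : ℕ) [NeZero m] (χ : DirichletCharacter ℚ_[p] m) (k : ℕ),
      (p = 7 ∨ p = 11 ∨ p = 19 ∨ p = 43 ∨ p = 67 ∨ p = 163) →
      m.Coprime p → χ.IsPrimitive → χ.IsQuadratic → (k = (p + 1) / 4 ∨ k = (3 * p - 1) / 4) →
      2 ≤ k → k ≤ p - 2 → χ (-1) * (-1) ^ k = -1 →
      (∃ (K₀ : Type) (_ : Field K₀) (_ : NumberField K₀) (ε₀ : DirichletCharacter ℚ_[p] (NumberField.discr K₀).natAbs),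
        IsImaginaryQuadratic K₀ ∧
        (∀ q : ℕ, q.Prime → q ∣ m → ((Ideal.span {(q : ℤ)}).primesOver (𝓞 K₀)).ncard = 2) ∧
        Odd (NumberField.discr K₀) ∧ NumberField.discr K₀ < -4 ∧ IsKroneckerCharacterOf K₀ ε₀ ∧
        ¬ ‖(k : ℚ_[p])⁻¹ * @generalizedBernoulli ℚ_[p] _ _
            (changeLevel (dvd_mul_right m (NumberField.discr K₀).natAbs) χ *
              changeLevel (dvd_mul_left (NumberField.discr K₀).natAbs m) ε₀).conductor ⟨conductor_ne_zero _⟩ k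
            (changeLevel (dvd_mul_right m (NumberField.discr K₀).natAbs) χ *
              changeLevel (dvd_mul_left (NumberField.discr K₀).natAbs m) ε₀).primitiveCharacter‖ ≤ (p : ℝ)⁻¹) →
      ∃ (K : Type) (_ : Field K) (_ : NumberField K) (εK : DirichletCharacter ℚ_[p] (NumberField.discr K).natAbs),
        IsImaginaryQuadratic K ∧
        (∀ q : ℕ, q.Prime → q ∣ p * m → ((Ideal.span {(q : ℤ)}).primesOver (𝓞 K)).ncard = 2) ∧
        Odd (NumberField.discr K) ∧ NumberField.discr K < -4 ∧ IsKroneckerCharacterOf K εK ∧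
        ¬ ‖(k : ℚ_[p])⁻¹ * @generalizedBernoulli ℚ_[p] _ _
            (changeLevel (dvd_mul_right m (NumberField.discr K).natAbs) χ *
              changeLevel (dvd_mul_left (NumberField.discr K).natAbs m) εK).conductor ⟨conductor_ne_zero _⟩ k
            (changeLevel (dvd_mul_right m (NumberField.discr K).natAbs) χ *
              changeLevel (dvd_mul_left (NumberField.discr K).natAbs m) εK).primitiveCharacter‖ ≤ (p : ℝ)⁻¹)
    (hCusp : ∀ (p : ℕ) [Fact p.Prime] (m : ℕ) [NeZero m] (χ : DirichletCharacter ℚ_[p] m) (k : ℕ),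
      (p = 7 ∨ p = 11 ∨ p = 19 ∨ p = 43 ∨ p = 67 ∨ p = 163) →
      m.Coprime p → χ.IsPrimitive → χ.IsQuadratic → (k = (p + 1) / 4 ∨ k = (3 * p - 1) / 4) →
      2 ≤ k → k ≤ p - 2 → χ (-1) * (-1) ^ k = -1 →
      ¬ (∃ ℓ : ℕ, ℓ.Prime ∧ ℓ ∣ m ∧ (ℓ % p = 1 ∨ ℓ % p = p - 1)) →
      ∃ (K₀ : Type) (_ : Field K₀) (_ : NumberField K₀) (ε₀ : DirichletCharacter ℚ_[p] (NumberField.discr K₀).natAbs),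
        IsImaginaryQuadratic K₀ ∧
        (∀ q : ℕ, q.Prime → q ∣ m → ((Ideal.span {(q : ℤ)}).primesOver (𝓞 K₀)).ncard = 2) ∧
        Odd (NumberField.discr K₀) ∧ NumberField.discr K₀ < -4 ∧ IsKroneckerCharacterOf K₀ ε₀ ∧
        ¬ ‖(k : ℚ_[p])⁻¹ * @generalizedBernoulli ℚ_[p] _ _
            (changeLevel (dvd_mul_right m (NumberField.discr K₀).natAbs) χ *
              changeLevel (dvd_mul_left (NumberField.discr K₀).natAbs m) ε₀).conductor ⟨conductor_ne_zero _⟩ k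
            (changeLevel (dvd_mul_right m (NumberField.discr K₀).natAbs) χ *
              changeLevel (dvd_mul_left (NumberField.discr K₀).natAbs m) ε₀).primitiveCharacter‖ ≤ (p : ℝ)⁻¹)
    (hExcGI : ∀ (p : ℕ) [Fact p.Prime] (m : ℕ) [NeZero m] (χ : DirichletCharacter ℚ_[p] m) (k : ℕ),
      (p = 7 ∨ p = 11 ∨ p = 19 ∨ p = 43 ∨ p = 67 ∨ p = 163) →
      m.Coprime p → χ.IsPrimitive → χ.IsQuadratic → (k = (p + 1) / 4 ∨ k = (3 * p - 1) / 4) →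
      2 ≤ k → k ≤ p - 2 → χ (-1) * (-1) ^ k = -1 →
      ¬ ((∀ q : ℕ, q.Prime → q ∣ m → q ≠ 2 → jacobiSym (-(p : ℤ)) q = 1) ∧ (2 ∣ m → p % 8 = 7)) →
      (∃ ℓ : ℕ, ℓ.Prime ∧ ℓ ∣ m ∧ (ℓ % p = 1 ∨ ℓ % p = p - 1)) →
      ¬ (p = 7 ∧ χ (-1) = -1 ∧ χ (7 : ZMod m) = 1) →
      ¬ ‖((p - k : ℕ) : ℚ_[p])⁻¹ * generalizedBernoulli (p - k) χ‖ ≤ (p : ℝ)⁻¹ →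
      ∃ (K₀ : Type) (_ : Field K₀) (_ : NumberField K₀) (ε₀ : DirichletCharacter ℚ_[p] (NumberField.discr K₀).natAbs),
        IsImaginaryQuadratic K₀ ∧
        (∀ q : ℕ, q.Prime → q ∣ m → ((Ideal.span {(q : ℤ)}).primesOver (𝓞 K₀)).ncard = 2) ∧
        Odd (NumberField.discr K₀) ∧ NumberField.discr K₀ < -4 ∧ IsKroneckerCharacterOf K₀ ε₀ ∧
        ¬ ‖(k : ℚ_[p])⁻¹ * @generalizedBernoulli ℚ_[p] _ _
            (changeLevel (dvd_mul_right m (NumberField.discr K₀).natAbs) χ *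
              changeLevel (dvd_mul_left (NumberField.discr K₀).natAbs m) ε₀).conductor ⟨conductor_ne_zero _⟩ k
            (changeLevel (dvd_mul_right m (NumberField.discr K₀).natAbs) χ *
              changeLevel (dvd_mul_left (NumberField.discr K₀).natAbs m) ε₀).primitiveCharacter‖ ≤ (p : ℝ)⁻¹) :
    ∀ (p : ℕ) [Fact p.Prime] (m : ℕ) [NeZero m] (χ : DirichletCharacter ℚ_[p] m) (k : ℕ),
      (p = 7 ∨ p = 11 ∨ p = 19 ∨ p = 43 ∨ p = 67 ∨ p = 163) →
      m.Coprime p → χ.IsPrimitive → χ.IsQuadratic → (k = (p + 1) / 4 ∨ k = (3 * p - 1) / 4) →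
      2 ≤ k → k ≤ p - 2 → χ (-1) * (-1) ^ k = -1 →
      (p = 7 → χ (-1) = -1 → χ (7 : ZMod m) = 1 → ¬ (∃ ℓ : ℕ, ℓ.Prime ∧ ℓ ∣ m ∧ (ℓ % p = 1 ∨ ℓ % p = p - 1))) →
      ¬ ‖((p - k : ℕ) : ℚ_[p])⁻¹ * generalizedBernoulli (p - k) χ‖ ≤ (p : ℝ)⁻¹ →
      ∃ (K : Type) (_ : Field K) (_ : NumberField K) (εK : DirichletCharacter ℚ_[p] (NumberField.discr K).natAbs),
        IsImaginaryQuadratic K ∧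
        (∀ q : ℕ, q.Prime → q ∣ p * m → ((Ideal.span {(q : ℤ)}).primesOver (𝓞 K)).ncard = 2) ∧
        Odd (NumberField.discr K) ∧ NumberField.discr K < -4 ∧ IsKroneckerCharacterOf K εK ∧
        ¬ ‖(k : ℚ_[p])⁻¹ * @generalizedBernoulli ℚ_[p] _ _
            (changeLevel (dvd_mul_right m (NumberField.discr K).natAbs) χ *
              changeLevel (dvd_mul_left (NumberField.discr K).natAbs m) εK).conductor ⟨conductor_ne_zero _⟩ k
            (changeLevel (dvd_mul_right m (NumberField.discr K).natAbs) χ *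
              changeLevel (dvd_mul_left (NumberField.discr K).natAbs m) εK).primitiveCharacter‖ ≤ (p : ℝ)⁻¹ := by
  intro p _ m _ χ k hp6 hmp hχ hχq hk hk2 hkp hpar hGIoff hcls
  by_cases hE : (∃ ℓ : ℕ, ℓ.Prime ∧ ℓ ∣ m ∧ (ℓ % p = 1 ∨ ℓ % p = p - 1))
  · by_cases hL : ((∀ q : ℕ, q.Prime → q ∣ m → q ≠ 2 → jacobiSym (-(p : ℤ)) q = 1) ∧ (2 ∣ m → p % 8 = 7))
    · exact hAt p m χ k hp6 hmp hχ hχq hk hk2 hkp hpar (seedOn_six p m χ k hp6 hmp hχ hχq hk hk2 hkp hpar hL hcls)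
    · have hnGI : ¬ (p = 7 ∧ χ (-1) = -1 ∧ χ (7 : ZMod m) = 1) :=
        fun h ↦ hGIoff h.1 h.2.1 h.2.2 hE
      exact hAt p m χ k hp6 hmp hχ hχq hk hk2 hkp hpar (hExcGI p m χ k hp6 hmp hχ hχq hk hk2 hkp hpar hL hE hnGI hcls)
  · exact hAt p m χ k hp6 hmp hχ hχq hk hk2 hkp hpar (hCusp p m χ k hp6 hmp hχ hχq hk hk2 hkp hpar hE)

end Summit.BirchSwinnertonDyer.BirchSwinnertonDyer.Theorems.PrintCFram.GenusInternalRouting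

end
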